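import Literature.NumberTheory.EllipticCurves.DeligneSerreRankinProp55LevelProofs
import Literature.NumberTheory.EllipticCurves.DeligneSerreProp27WeightOneDescentProofs
import Literature.NumberTheory.EllipticCurves.NewformsMainLemmaProofs
import HarnessLib

/-!
# Deligne–Serre 1974, Prop. 5.5 from inputs at the levels divisible by `8` only, in ONE weight:
# level raising `N ↦ 8N` for Prop. 5.5 and the `θ²`-descent to weight one

A proofs-only continuation (theorems only; no definition, no named fact, nothing restated; D-0026)
of `DeligneSerreRankinProp55LevelProofs`, which reduced the named fact
`Literature.NumberTheory.EllipticCurves.ModularForms.DeligneSerre1974.prop55` (Deligne–Serre 1974,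
Prop. 5.5) to Deligne–Serre's spanning statement (2.7.2) **in weight one** at the level of the form
(`prop55_at_of_span_integralLattice1_one`).  Weight one is reached there from the odd weights
`5, 7` (division by `E₄`, `E₆`), i.e. from the rank half of Eichler–Shimura for `Γ₁(N)` in **odd**
weight.  The tree's Manin-symbol route to that rank half (`ManinSymbolsWeightKGamma1RankProofs`:
boundary symbols for `Γ ≤ Γ' ∋ -1`, Manin–Drinfeld above `∞`) is written for **even** `n`, and
`DeligneSerreProp27WeightOneDescentProofs` supplies the bridge from even weight to weight one: at the
levels `8 ∣ M`, (2.7.2) descends from any weight `K₀` to every weight `k ≤ K₀` by division by the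
weight-one `η`-quotients `θ²`, `θ(2τ)²` (`DeligneSerre1974_span_integralLattice1.of_le_of_eight_dvd`).
This file moves Prop. 5.5 onto that bridge:

* `prop55_of_span_integralLattice1_one_of_eight_dvd` — **level raising for Prop. 5.5**: for
  `0 ≠ f ∈ S₁(N, ε)`, eigen for the `T_p` (`p ∤ N`), the old form `ι f = [α₁] f ∈ S₁(Γ₁(8N))` is
  non-zero (`degeneracyMap1_one_ne_zero`), of type `(1, ε')` with `ε'` the level-`8N` character
  induced by `ε` (`diamondOp_degeneracyMap1`), and `T_p (ι f) = ι (T_p f) = a_p ι f` for every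
  `p ∤ 8N` (`heckeT_degeneracyMap1_of_not_dvd`); so Prop. 5.5 at level `8N`
  (`prop55_at_of_span_integralLattice1_one`, from (2.7.2) at `(8N, 1)`) yields the sets `X_η`,
  `Y_η` for the `a_p`, `p ∤ 8N`, and the single remaining prime `p = 2` (when `2 ∤ N`) is absorbed
  into the finite set `Y_η ∪ {a₂}`.  Hence **Prop. 5.5 follows from (2.7.2) in weight `1` at the
  levels divisible by `8`.**
* `prop55_of_span_integralLattice1_of_eight_dvd` — from (2.7.2) in ONE weight `K₀ ≥ 1` at the levels
  `8 ∣ M` (the `θ²`-descent);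
* `prop55_of_heckeStableRealLattice_of_eight_dvd` — from a full Hecke-stable real lattice in
  `S_{K₀}(Γ₁(M))^∨`, one weight `K₀ ≥ 2`, all `8 ∣ M` (Shimura 1971, (3.5.20), Thm. 3.52);
* **`prop55_of_periodLatticeK1_eq_span_of_eight_dvd`** — from the rank half of Eichler–Shimura for
  `Γ₁(M)`, `8 ∣ M`, in ONE weight `n + 2` with `n ≥ 5` (**`n` may be even**, e.g. `n = 6`):
  `periodLatticeK1 n` is the `ℤ`-span of `2 dim_ℂ S_{n+2}(Γ₁(M))` functionals
  (`heckeStableRealLatticeOfGenerators` supplies the spanning half, `n ≥ 5`).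

This is the exact hypothesis shape of `prop27_eigenvalues_of_forall_periodLatticeK1_eq_span_of_five_le`
(`DeligneSerreProp27WeightOneDescentProofs`), so one rank theorem in one even weight at the levels
`8 ∣ M` discharges both (2.7.3) and Prop. 5.5.

## References

* P. Deligne, J.-P. Serre, *Formes modulaires de poids 1*, Ann. Sci. ÉNS (4) 7 (1974), 507–530:
  Prop. 2.7 and Rem. 2.8 (p. 512), Prop. 5.1, Prop. 5.5 (pp. 518–520). [DeligneSerreASENS1974]
* F. Diamond, J. Shurman, *A first course in modular forms*, GTM 228 (2005), Prop. 5.6.2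
  (degeneracy maps commute with `T_p`, `p ∤ N`, and with `⟨d⟩`).
* G. Shimura, *Introduction to the arithmetic theory of automorphic functions* (1971), (3.5.20),
  Thm. 3.52, Thm. 8.4.
-/

noncomputable section

open scoped MatrixGroups ModularForm Topology

open CongruenceSubgroup Filter UpperHalfPlane

namespace Literature.NumberTheory.EllipticCurves.ModularForms.DeligneSerre1974

/-! ### Level raising `N ↦ 8N` for Prop. 5.5 -/

/-- **The old form `[α₁] f ∈ S_k(Γ₁(N'))` of a form of type `(k, ε)` on `Γ₁(N)` is of type
`(k, ε')`, `ε'` the character of level `N'` induced by `ε`** (`N ∣ N'`; Diamond–Shurman Prop. 5.6.2: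
`⟨d⟩_{N'} [α₁] = [α₁] ⟨d mod N⟩_N`). [cite: DiamondShurman2005, Prop. 5.6.2] -/
theorem degeneracyMap1_one_mem_nebentypusSubspace {N N' : ℕ} [NeZero N] [NeZero N'] {k : ℤ}
    (hN : N ∣ N') (ε : DirichletCharacter ℂ N) {f : CuspForm (Gamma1 N) k}
    (hfε : f ∈ nebentypusSubspace N k ε) :
    degeneracyMap1 N N' 1 k f ∈ nebentypusSubspace N' k (DirichletCharacter.changeLevel hN ε) := by
  have hN1 : N * 1 ∣ N' := by simpa using hN
  have hfε' := mem_nebentypusSubspace_iff_diamondOp.mp hfε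
  rw [mem_nebentypusSubspace_iff_diamondOp]
  intro d
  rw [diamondOp_degeneracyMap1 N' k hN1 d.isUnit f]
  obtain ⟨u, hu⟩ := d.isUnit.map (ZMod.castHom ((dvd_mul_right N 1).trans hN1) (ZMod N))
  rw [← hu, hfε' u, map_smul, DirichletCharacter.changeLevel_eq_cast_of_dvd ε hN d, hu,
    ZMod.castHom_apply]

/-- **`T_p [α₁] f = a_p [α₁] f` at level `8N` for `p ∤ 8N`**, if `T_p f = a_p f` at level `N`
(Diamond–Shurman Prop. 5.6.2, `heckeT_degeneracyMap1_of_not_dvd`). [cite: DiamondShurman2005, Prop. 5.6.2] -/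
theorem heckeT_degeneracyMap1_one_eight_mul {N : ℕ} [NeZero N] [NeZero (8 * N)] {k : ℤ} {p : ℕ}
    [NeZero p] (hp : p.Prime) (hp8N : ¬ p ∣ 8 * N) (f : CuspForm (Gamma1 N) k) {a : ℂ}
    (ha : heckeT (Gamma1 N) k p f = a • f) :
    heckeT (Gamma1 (8 * N)) k p (degeneracyMap1 N (8 * N) 1 k f) =
      a • degeneracyMap1 N (8 * N) 1 k f := by
  have hN1 : N * 1 ∣ 8 * N := ⟨8, by ring⟩
  have hp2 : p ≠ 2 := fun h ↦ hp8N (h ▸ ⟨4 * N, by ring⟩)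
  rw [heckeT_degeneracyMap1_of_not_dvd (M := N) (N := 8 * N) (d := 1) k hN1 hp
    (fun h ↦ hp.ne_one (Nat.dvd_one.mp h)) (odd_prime_dvd_eight_mul_iff hp hp2), ha, map_smul]

/-- **Deligne–Serre 1974, Prop. 5.5, from (2.7.2) in weight one at the levels divisible by `8`**
(level raising `N ↦ 8N`: apply Prop. 5.5 at level `8N`, `prop55_at_of_span_integralLattice1_one`,
to the old form `[α₁] f`, and absorb `a₂` into the finite set). [cite: DeligneSerreASENS1974, Prop. 5.5] -/
theorem prop55_of_span_integralLattice1_one_of_eight_dvd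
    (hL : ∀ (M : ℕ) [NeZero M], 8 ∣ M → DeligneSerre1974_span_integralLattice1 M 1) : prop55 := by
  intro N _ ε f hfε hf0 heigen θ hθ
  classical
  haveI : NeZero (8 * N) := ⟨mul_ne_zero (by norm_num) (NeZero.ne N)⟩
  have hL' : DeligneSerre1974_span_integralLattice1 (8 * N) 1 := hL (8 * N) (dvd_mul_right 8 N)
  have hN8 : N ∣ 8 * N := dvd_mul_left N 8
  set v₁ := degeneracyMap1 N (8 * N) 1 1 f with hv₁
  have hv₁0 : v₁ ≠ 0 := degeneracyMap1_one_ne_zero hN8 hf0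
  have hv₁ε : v₁ ∈ nebentypusSubspace (8 * N) 1 (DirichletCharacter.changeLevel hN8 ε) :=
    degeneracyMap1_one_mem_nebentypusSubspace hN8 ε hfε
  have heig' : ∀ p : ℕ, (hp : p.Prime) → ¬ p ∣ 8 * N →
      ∃ a : ℂ, (haveI : NeZero p := ⟨hp.ne_zero⟩; heckeT (Gamma1 (8 * N)) 1 p v₁) = a • v₁ := by
    intro p hp hp8N
    haveI : NeZero p := ⟨hp.ne_zero⟩
    obtain ⟨a, ha⟩ := heigen p hp (fun h ↦ hp8N (h.mul_left 8))
    exact ⟨a, heckeT_degeneracyMap1_one_eight_mul hp hp8N f ha⟩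
  obtain ⟨X, Y, hX, hY⟩ := prop55_at_of_span_integralLattice1_one prop51_holds hL'
    (DirichletCharacter.changeLevel hN8 ε) v₁ hv₁ε hv₁0 heig' θ hθ
  refine ⟨X, insert (heckeEigenvalue f 2) Y, hX, fun p hp hpN hpX ↦ ?_⟩
  by_cases hp2 : p = 2
  · subst hp2
    exact Finset.mem_insert_self _ _
  · have hp8N : ¬ p ∣ 8 * N := fun h ↦ hpN ((odd_prime_dvd_eight_mul_iff hp hp2).mpr h)
    haveI : NeZero p := ⟨hp.ne_zero⟩
    obtain ⟨a, ha⟩ := heigen p hp hpN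
    have h1 : heckeEigenvalue f p = a := heckeEigenvalue_eq_of_eq_smul hf0 ha
    have h2 : heckeEigenvalue v₁ p = a :=
      heckeEigenvalue_eq_of_eq_smul hv₁0 (heckeT_degeneracyMap1_one_eight_mul hp hp8N f ha)
    rw [h1, ← h2]
    exact Finset.mem_insert_of_mem (hY p hp hp8N hpX)

/-! ### One weight at the levels `8 ∣ M` suffices -/

/-- **Prop. 5.5 from (2.7.2) in ONE weight `K₀ ≥ 1` at the levels divisible by `8`** (the
`θ²`-descent `DeligneSerre1974_span_integralLattice1.of_le_of_eight_dvd` down to weight one).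
[cite: DeligneSerreASENS1974, Prop. 5.5, Prop. 2.7 (2.7.2) and Rem. 2.8] -/
theorem prop55_of_span_integralLattice1_of_eight_dvd {K₀ : ℤ} (hK₀ : 1 ≤ K₀)
    (hL : ∀ (M : ℕ) [NeZero M], 8 ∣ M → DeligneSerre1974_span_integralLattice1 M K₀) : prop55 :=
  prop55_of_span_integralLattice1_one_of_eight_dvd fun M _ h8 ↦
    DeligneSerre1974_span_integralLattice1.of_le_of_eight_dvd h8 (hL M h8) hK₀

/-- **Prop. 5.5 from a full Hecke-stable real lattice in ONE weight `K₀ ≥ 2` at the levels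
divisible by `8`** (Shimura 1971, (3.5.20); through his Thm. 3.52,
`DeligneSerre1974_span_integralLattice1_of_heckeStableRealLattice`).
[cite: DeligneSerreASENS1974, Prop. 5.5 and Prop. 2.7 (2.7.2)] -/
theorem prop55_of_heckeStableRealLattice_of_eight_dvd {K₀ : ℤ} (hK₀ : 2 ≤ K₀)
    (H : ∀ (M : ℕ) [NeZero M], 8 ∣ M → Nonempty (HeckeStableRealLattice M K₀)) : prop55 :=
  prop55_of_span_integralLattice1_of_eight_dvd (by omega : (1 : ℤ) ≤ K₀) fun M _ h8 ↦
    (H M h8).elim fun Λ ↦ DeligneSerre1974_span_integralLattice1_of_heckeStableRealLattice hK₀ Λ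

/-- **Deligne–Serre 1974, Prop. 5.5, from the rank half of the Eichler–Shimura isomorphism for
`Γ₁(M)`, `8 ∣ M`, in ONE weight `n + 2` with `n ≥ 5` — `n` of either parity.**  If for every `M`
with `8 ∣ M` the period lattice `periodLatticeK1 n ⊆ S_{n+2}(Γ₁(M))^∨` is the `ℤ`-span of
`2 dim_ℂ S_{n+2}(Γ₁(M))` functionals (Shimura 1971, Thm. 8.4 with (8.2.23)), then Prop. 5.5 holds:
the lattice spans the dual over `ℝ` (`periodLatticeK1_span_real_eq_top`, `n ≥ 5`), so it is a full
Hecke-stable real lattice (`heckeStableRealLatticeOfGenerators`), which gives (2.7.2) in weight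
`n + 2` at these levels, hence in weight one there by the `θ²`-descent, hence Prop. 5.5 at every
level by level raising.  Same hypothesis as
`prop27_eigenvalues_of_forall_periodLatticeK1_eq_span_of_five_le`.
[cite: DeligneSerreASENS1974, Prop. 5.5; Shimura1971, (3.5.20), Thm. 3.52, Thm. 8.4] -/
theorem prop55_of_periodLatticeK1_eq_span_of_eight_dvd (n : ℕ) (hn : 5 ≤ n)
    (H : ∀ (M : ℕ) [NeZero M], 8 ∣ M →
      ∃ g : Fin (2 * Module.finrank ℂ (CuspForm (Gamma1 M) (n + 2))) →
          Module.Dual ℂ (CuspForm (Gamma1 M) (n + 2)),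
        (periodLatticeK1 (N := M) n : Set (Module.Dual ℂ (CuspForm (Gamma1 M) (n + 2)))) =
          Submodule.span ℤ (Set.range g)) : prop55 :=
  prop55_of_heckeStableRealLattice_of_eight_dvd (K₀ := n + 2) (by omega) fun M _ h8 ↦ by
    obtain ⟨g, hg⟩ := H M h8
    exact ⟨heckeStableRealLatticeOfGenerators hn g hg⟩

end Literature.NumberTheory.EllipticCurves.ModularForms.DeligneSerre1974
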